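import Mathlib
import Summits.Ventures.HodgeRepro.Tier4.Common.AutForms

/-!
# Tier4/Common/HoloEstimates — Cauchy estimates on the ball: a bound on a holomorphic function gives a bound on its
derivative, hence a Lipschitz bound, on a smaller closed ball

Blind re-derivation cell `pub-hodge-repro`, Tier 4 (README §9–§10), seat t4-typer-1 (gen 1).  Target tree path
`lean/Summits/Ventures/HodgeRepro/Tier4/Common/HoloEstimates.lean`.  Imports `Tier4/Common/AutForms.lean` (typer-1:
`pd`, `nsq`, `ball`, `continuous_nsq`, `isOpen_ball`, `sq_convex_combo`).

WHY.  The finite-dimensionality (T2) of the holomorphic forms of the compact quotient `X_{Γ′}` (Cartan–Serre) is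
proved in `Tier4/Common/HoloFinite.lean` by Arzelà–Ascoli + Riesz; the equicontinuity input is the classical
Cauchy estimate: a holomorphic function bounded by `M` on `{nsq < r₂}` has partial derivatives bounded by
`M / ρ` on `{nsq ≤ r₁}` (`r₁ < r₂`, `ρ = (r₂ − r₁) / 4`), hence is Lipschitz there with constant `2M / ρ`.
Everything here is Mathlib-level analysis on `ℂ²`; nothing of the target's objects enters.

WHAT IS PROVED.  `forall_norm_le_of_ae` (an a.e. bound of a function continuous on an open set holds everywhere on
it); the closed sub-balls `cball r = {nsq ≤ r}`: closed, compact, convex, inside `ball` for `r < 1`, and the open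
`oball r = {nsq < r}`; the line lemma `nsq_add_single_lt` (the complex line `z + t·e_k` stays in `oball r₂` for
`|t| ≤ (r₂ − r₁)/4`); **`norm_pd_le_of_bounded`** (the Cauchy estimate on a complex line), `norm_fderiv_le_of_bounded`,
**`norm_sub_le_of_bounded`** (the Lipschitz bound on `cball r₁`).

Nothing here says anything about the status of the Hodge conjecture for CM abelian varieties, which is NOT proved
(HC_CM is NOT proved by anyone in this repository).
-/

set_option autoImplicit false

noncomputable section

open MeasureTheory Set
open scoped Topology

namespace Summit.Ventures.HodgeRepro.Tier4

/-! ## An a.e. bound on an open set is an everywhere bound (for a continuous function) -/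

/-- If `f` is continuous on the open set `U` and `‖f‖ ≤ M` almost everywhere on `U`, then `‖f z‖ ≤ M` for every
`z ∈ U` (the exceptional set is open and null, hence empty). -/
theorem forall_norm_le_of_ae {β : Type} [NormedAddCommGroup β] {U : Set (Fin 2 → ℂ)} (hU : IsOpen U)
    {f : (Fin 2 → ℂ) → β} (hf : ContinuousOn f U) {M : ℝ} (h : ∀ᵐ z ∂(volume.restrict U), ‖f z‖ ≤ M) :
    ∀ z ∈ U, ‖f z‖ ≤ M := by
  have hV : IsOpen (U ∩ (fun z => ‖f z‖) ⁻¹' Ioi M) := hf.norm.isOpen_inter_preimage hU isOpen_Ioi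
  have hnull : volume (U ∩ (fun z => ‖f z‖) ⁻¹' Ioi M) = 0 := by
    rw [ae_restrict_iff' hU.measurableSet, ae_iff] at h
    refine measure_mono_null (fun z hz => ?_) h
    simp only [mem_setOf_eq]
    intro himp
    exact absurd (himp hz.1) (not_le.2 hz.2)
  have hempty := (hV.measure_eq_zero_iff volume).1 hnull
  intro z hz
  by_contra hlt
  have : z ∈ U ∩ (fun z => ‖f z‖) ⁻¹' Ioi M := ⟨hz, not_le.1 hlt⟩
  rw [hempty] at this
  exact this

/-! ## The closed and open sub-balls `{nsq ≤ r}`, `{nsq < r}` -/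

/-- The closed sub-ball `{nsq ≤ r}`. -/
def cball (r : ℝ) : Set (Fin 2 → ℂ) := {z | nsq z ≤ r}

/-- The open sub-ball `{nsq < r}`. -/
def oball (r : ℝ) : Set (Fin 2 → ℂ) := {z | nsq z < r}

/-- Membership in `cball r`. -/
theorem mem_cball {r : ℝ} {z : Fin 2 → ℂ} : z ∈ cball r ↔ nsq z ≤ r := Iff.rfl

/-- Membership in `oball r`. -/
theorem mem_oball {r : ℝ} {z : Fin 2 → ℂ} : z ∈ oball r ↔ nsq z < r := Iff.rfl

/-- `oball r ⊆ cball r`. -/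
theorem oball_subset_cball (r : ℝ) : oball r ⊆ cball r := fun _ hz => mem_cball.2 (le_of_lt (mem_oball.1 hz))

/-- `cball r₁ ⊆ oball r₂` for `r₁ < r₂`. -/
theorem cball_subset_oball {r₁ r₂ : ℝ} (h : r₁ < r₂) : cball r₁ ⊆ oball r₂ := fun _ hz => mem_oball.2 (lt_of_le_of_lt (mem_cball.1 hz) h)

/-- `cball r ⊆ ball` for `r < 1`. -/
theorem cball_subset_ball {r : ℝ} (hr : r < 1) : cball r ⊆ ball := fun _ hz => show nsq _ < 1 from lt_of_le_of_lt (mem_cball.1 hz) hr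

/-- `oball r ⊆ ball` for `r ≤ 1`. -/
theorem oball_subset_ball {r : ℝ} (hr : r ≤ 1) : oball r ⊆ ball := fun _ hz => show nsq _ < 1 from lt_of_lt_of_le (mem_oball.1 hz) hr

/-- `oball r` is open. -/
theorem isOpen_oball (r : ℝ) : IsOpen (oball r) := isOpen_lt continuous_nsq continuous_const

/-- `cball r` is closed. -/
theorem isClosed_cball (r : ℝ) : IsClosed (cball r) := isClosed_le continuous_nsq continuous_const

/-- `‖z‖ ≤ 1` on `cball r` for `r ≤ 1` (sup norm: each coordinate has `|z_k|² ≤ nsq z ≤ 1`). -/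
theorem norm_le_one_of_mem_cball {r : ℝ} (hr : r ≤ 1) {z : Fin 2 → ℂ} (hz : z ∈ cball r) : ‖z‖ ≤ 1 := by
  rw [pi_norm_le_iff_of_nonneg zero_le_one]
  intro k
  have h0 : 0 ≤ ‖z 0‖ ^ 2 := sq_nonneg _
  have h1 : 0 ≤ ‖z 1‖ ^ 2 := sq_nonneg _
  have hz' : ‖z 0‖ ^ 2 + ‖z 1‖ ^ 2 ≤ 1 := le_trans hz hr
  have hk : ‖z k‖ ^ 2 ≤ 1 := by fin_cases k <;> simp only [Fin.zero_eta, Fin.mk_one] <;> linarith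
  nlinarith [norm_nonneg (z k)]

/-- `cball r` is bounded. -/
theorem isBounded_cball (r : ℝ) : Bornology.IsBounded (cball r) := by
  rcases le_or_gt r 1 with hr | hr
  · exact (Metric.isBounded_closedBall (x := (0 : Fin 2 → ℂ)) (r := 1)).subset fun z hz => by
      simpa using norm_le_one_of_mem_cball hr hz
  · -- `cball r ⊆ closedBall 0 √r`: each coordinate has `|z_k|² ≤ r`
    refine (Metric.isBounded_closedBall (x := (0 : Fin 2 → ℂ)) (r := Real.sqrt r)).subset fun z hz => ?_
    rw [Metric.mem_closedBall, dist_zero_right, pi_norm_le_iff_of_nonneg (Real.sqrt_nonneg r)]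
    intro k
    rw [Real.le_sqrt (norm_nonneg _) (by linarith)]
    have h0 : 0 ≤ ‖z 0‖ ^ 2 := sq_nonneg _
    have h1 : 0 ≤ ‖z 1‖ ^ 2 := sq_nonneg _
    have hz' : ‖z 0‖ ^ 2 + ‖z 1‖ ^ 2 ≤ r := hz
    fin_cases k <;> simp only [Fin.zero_eta, Fin.mk_one] <;> linarith

/-- `cball r` is compact. -/
theorem isCompact_cball (r : ℝ) : IsCompact (cball r) :=
  Metric.isCompact_of_isClosed_isBounded (isClosed_cball r) (isBounded_cball r)

/-- `cball r` is convex. -/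
theorem convex_cball (r : ℝ) : Convex ℝ (cball r) := by
  intro x hx y hy a b ha hb hab
  simp only [cball, nsq, Set.mem_setOf_eq] at hx hy ⊢
  have key : ∀ i : Fin 2, ‖(a • x + b • y) i‖ ^ 2 ≤ a * ‖x i‖ ^ 2 + b * ‖y i‖ ^ 2 := by
    intro i
    have h1 : ‖(a • x + b • y) i‖ ≤ a * ‖x i‖ + b * ‖y i‖ := by
      simp only [Pi.add_apply, Pi.smul_apply]
      calc ‖a • x i + b • y i‖ ≤ ‖a • x i‖ + ‖b • y i‖ := norm_add_le _ _
        _ = a * ‖x i‖ + b * ‖y i‖ := by rw [norm_smul, norm_smul, Real.norm_of_nonneg ha, Real.norm_of_nonneg hb]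
    have h2 : ‖(a • x + b • y) i‖ ^ 2 ≤ (a * ‖x i‖ + b * ‖y i‖) ^ 2 :=
      pow_le_pow_left₀ (norm_nonneg _) h1 2
    exact h2.trans (sq_convex_combo ha hb hab)
  have h0 := key 0
  have h1 := key 1
  have hxs : a * (‖x 0‖ ^ 2 + ‖x 1‖ ^ 2) ≤ a * r := mul_le_mul_of_nonneg_left hx ha
  have hys : b * (‖y 0‖ ^ 2 + ‖y 1‖ ^ 2) ≤ b * r := mul_le_mul_of_nonneg_left hy hb
  have : a * r + b * r = r := by rw [← add_mul, hab, one_mul]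
  nlinarith [h0, h1, hxs, hys]

/-- A compact subset of the ball lies in some `cball r` with `r < 1`. -/
theorem exists_cball_of_isCompact {K : Set (Fin 2 → ℂ)} (hK : IsCompact K) (hKb : K ⊆ ball) :
    ∃ r : ℝ, r < 1 ∧ K ⊆ cball r := by
  rcases K.eq_empty_or_nonempty with hKe | hKne
  · exact ⟨0, zero_lt_one, by rw [hKe]; exact empty_subset _⟩
  · obtain ⟨z₀, hz₀, hmax⟩ := hK.exists_isMaxOn hKne continuous_nsq.continuousOn
    exact ⟨nsq z₀, hKb hz₀, fun z hz => hmax hz⟩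

/-! ## The Cauchy estimate on a complex line -/

/-- `‖a + b‖² ≤ ‖a‖² + 2‖a‖‖b‖ + ‖b‖²`. -/
theorem norm_add_sq_le' (a b : ℂ) : ‖a + b‖ ^ 2 ≤ ‖a‖ ^ 2 + 2 * ‖a‖ * ‖b‖ + ‖b‖ ^ 2 := by
  have h1 : ‖a + b‖ ≤ ‖a‖ + ‖b‖ := norm_add_le _ _
  have h2 : ‖a + b‖ ^ 2 ≤ (‖a‖ + ‖b‖) ^ 2 := pow_le_pow_left₀ (norm_nonneg _) h1 2
  nlinarith

/-- Moving along the `k`-th coordinate axis by `t` changes `nsq` by at most `2‖t‖ + ‖t‖²` (for `‖z‖ ≤ 1`). -/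
theorem nsq_add_single_le (z : Fin 2 → ℂ) (k : Fin 2) (t : ℂ) (hz : ‖z‖ ≤ 1) :
    nsq (z + t • Pi.single k 1) ≤ nsq z + 2 * ‖t‖ + ‖t‖ ^ 2 := by
  have hz0 : ‖z 0‖ ≤ 1 := (norm_le_pi_norm z 0).trans hz
  have hz1 : ‖z 1‖ ≤ 1 := (norm_le_pi_norm z 1).trans hz
  have htn : 0 ≤ ‖t‖ := norm_nonneg t
  fin_cases k
  · have e00 : (Pi.single (0 : Fin 2) (1 : ℂ) : Fin 2 → ℂ) 0 = 1 := by simp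
    have e01 : (Pi.single (0 : Fin 2) (1 : ℂ) : Fin 2 → ℂ) 1 = 0 := by simp
    have hb := norm_add_sq_le' (z 0) t
    simp only [nsq, Fin.zero_eta, Fin.isValue, Pi.add_apply, Pi.smul_apply, e00, e01, smul_eq_mul, mul_one,
      mul_zero, add_zero]
    nlinarith
  · have e10 : (Pi.single (1 : Fin 2) (1 : ℂ) : Fin 2 → ℂ) 0 = 0 := by simp
    have e11 : (Pi.single (1 : Fin 2) (1 : ℂ) : Fin 2 → ℂ) 1 = 1 := by simp
    have hb := norm_add_sq_le' (z 1) t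
    simp only [nsq, Fin.mk_one, Fin.isValue, Pi.add_apply, Pi.smul_apply, e10, e11, smul_eq_mul, mul_one,
      mul_zero, add_zero]
    nlinarith

/-- For `z ∈ cball r₁`, `r₁ < r₂ ≤ 1`, and `‖t‖ ≤ (r₂ − r₁) / 3`, the point `z + t·e_k` lies in `oball r₂`. -/
theorem mem_oball_add_single {r₁ r₂ : ℝ} (h12 : r₁ < r₂) (h2 : r₂ ≤ 1) {z : Fin 2 → ℂ} (hz : z ∈ cball r₁)
    (k : Fin 2) {t : ℂ} (ht : ‖t‖ ≤ (r₂ - r₁) / 4) : z + t • Pi.single k 1 ∈ oball r₂ := by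
  have hz1 : ‖z‖ ≤ 1 := norm_le_one_of_mem_cball (le_trans h12.le h2) hz
  have hb := nsq_add_single_le z k t hz1
  have hr1 : 0 ≤ r₁ := le_trans (add_nonneg (sq_nonneg _) (sq_nonneg _) : (0:ℝ) ≤ nsq z) hz
  have hδ : 0 < r₂ - r₁ := by linarith
  have hδ1 : r₂ - r₁ ≤ 1 := by linarith
  have htn : 0 ≤ ‖t‖ := norm_nonneg t
  have ht2 : ‖t‖ ^ 2 ≤ (r₂ - r₁) / 4 := by
    have : ‖t‖ ^ 2 ≤ ‖t‖ * ((r₂ - r₁) / 4) := by nlinarith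
    have h3 : ‖t‖ * ((r₂ - r₁) / 4) ≤ (r₂ - r₁) / 4 := by
      have : ‖t‖ ≤ 1 := le_trans ht (by linarith)
      nlinarith
    linarith
  show nsq (z + t • Pi.single k 1) < r₂
  have hzr : nsq z ≤ r₁ := hz
  have : 2 * ‖t‖ + ‖t‖ ^ 2 ≤ 3 * ((r₂ - r₁) / 4) := by linarith
  linarith

/-- **The Cauchy estimate on a complex line.**  If `u` is holomorphic on `oball r₂` and bounded by `M` there, then
for `z ∈ cball r₁` (`r₁ < r₂ ≤ 1`) every partial derivative satisfies `‖∂_k u (z)‖ ≤ M / ρ`, `ρ = (r₂ − r₁) / 4`. -/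
theorem norm_pd_le_of_bounded {r₁ r₂ : ℝ} (h12 : r₁ < r₂) (h2 : r₂ ≤ 1) {u : (Fin 2 → ℂ) → ℂ}
    (hu : DifferentiableOn ℂ u (oball r₂)) {M : ℝ} (hM : ∀ w ∈ oball r₂, ‖u w‖ ≤ M) {z : Fin 2 → ℂ}
    (hz : z ∈ cball r₁) (k : Fin 2) : ‖pd k u z‖ ≤ M / ((r₂ - r₁) / 4) := by
  have hρpos : 0 < (r₂ - r₁) / 4 := by linarith
  set e : Fin 2 → ℂ := Pi.single k 1 with he
  set g : ℂ → ℂ := fun t => u (z + t • e) with hg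
  -- the line map and its derivative
  have hline : ∀ t : ℂ, HasDerivAt (fun s : ℂ => z + s • e) e t := fun t => by
    simpa using ((hasDerivAt_id t).smul_const e).const_add z
  -- points of the closed disc of radius `ρ` (indeed `(r₂ − r₁)/3`) map into `oball r₂`
  have hmem : ∀ t : ℂ, ‖t‖ ≤ (r₂ - r₁) / 4 → z + t • e ∈ oball r₂ := fun t ht =>
    mem_oball_add_single h12 h2 hz k ht
  have hopen : IsOpen (oball r₂) := isOpen_oball r₂
  -- `g` is differentiable on the closed disc of radius `ρ`
  have hgdiff : ∀ t : ℂ, ‖t‖ ≤ (r₂ - r₁) / 4 → DifferentiableAt ℂ g t := by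
    intro t ht
    have hut : DifferentiableAt ℂ u (z + t • e) := hu.differentiableAt (hopen.mem_nhds (hmem t ht))
    exact hut.comp t (hline t).differentiableAt
  have hdc : DiffContOnCl ℂ g (Metric.ball (0 : ℂ) ((r₂ - r₁) / 4)) := by
    refine DifferentiableOn.diffContOnCl ?_
    intro t ht
    have ht' : ‖t‖ ≤ (r₂ - r₁) / 4 := by
      have := Metric.closure_ball_subset_closedBall ht
      rw [Metric.mem_closedBall, dist_zero_right] at this
      linarith
    exact (hgdiff t ht').differentiableWithinAt
  have hsphere : ∀ t ∈ Metric.sphere (0 : ℂ) ((r₂ - r₁) / 4), ‖g t‖ ≤ M := by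
    intro t ht
    rw [Metric.mem_sphere, dist_zero_right] at ht
    have ht' : ‖t‖ ≤ (r₂ - r₁) / 4 := by rw [ht]
    exact hM _ (hmem t ht')
  have hcauchy := Complex.norm_deriv_le_of_forall_mem_sphere_norm_le hρpos hdc hsphere
  -- `deriv g 0 = ∂_k u z`
  have hderiv : HasDerivAt g (fderiv ℂ u z e) 0 := by
    have hz2 : z ∈ oball r₂ := cball_subset_oball h12 hz
    have hu0 : HasFDerivAt u (fderiv ℂ u z) z := (hu.differentiableAt (hopen.mem_nhds hz2)).hasFDerivAt
    have hu0' : HasFDerivAt u (fderiv ℂ u z) ((fun s : ℂ => z + s • e) 0) := by simpa using hu0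
    exact hu0'.comp_hasDerivAt 0 (hline 0)
  rw [hderiv.deriv] at hcauchy
  exact hcauchy

/-- `fderiv ℂ u z v = Σ_k v_k · ∂_k u z`. -/
theorem fderiv_apply_eq_sum {u : (Fin 2 → ℂ) → ℂ} (z v : Fin 2 → ℂ) :
    fderiv ℂ u z v = ∑ k : Fin 2, v k * pd k u z := by
  have hv : v = ∑ k : Fin 2, v k • (Pi.single k (1 : ℂ) : Fin 2 → ℂ) := by
    conv_lhs => rw [← Finset.univ_sum_single v]
    refine Finset.sum_congr rfl fun k _ => ?_
    ext j
    by_cases hj : j = k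
    · subst hj; simp
    · simp [Pi.single_eq_of_ne hj]
  conv_lhs => rw [hv]
  rw [map_sum]
  refine Finset.sum_congr rfl fun k _ => ?_
  rw [map_smul, smul_eq_mul]
  rfl

/-- **The derivative bound**: under the hypotheses of `norm_pd_le_of_bounded`, `‖fderiv ℂ u z‖ ≤ 2M / ρ` on
`cball r₁`. -/
theorem norm_fderiv_le_of_bounded {r₁ r₂ : ℝ} (h12 : r₁ < r₂) (h2 : r₂ ≤ 1) {u : (Fin 2 → ℂ) → ℂ}
    (hu : DifferentiableOn ℂ u (oball r₂)) {M : ℝ} (hM : ∀ w ∈ oball r₂, ‖u w‖ ≤ M) {z : Fin 2 → ℂ}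
    (hz : z ∈ cball r₁) : ‖fderiv ℂ u z‖ ≤ 2 * (M / ((r₂ - r₁) / 4)) := by
  have hM0 : 0 ≤ M := le_trans (norm_nonneg _) (hM z (cball_subset_oball h12 hz))
  have hρ : 0 < (r₂ - r₁) / 4 := by linarith
  have hC : 0 ≤ 2 * (M / ((r₂ - r₁) / 4)) := by positivity
  refine ContinuousLinearMap.opNorm_le_bound _ hC fun v => ?_
  rw [fderiv_apply_eq_sum]
  calc ‖∑ k : Fin 2, v k * pd k u z‖ ≤ ∑ k : Fin 2, ‖v k * pd k u z‖ := norm_sum_le _ _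
    _ ≤ ∑ k : Fin 2, ‖v‖ * (M / ((r₂ - r₁) / 4)) := by
        refine Finset.sum_le_sum fun k _ => ?_
        rw [norm_mul]
        exact mul_le_mul (norm_le_pi_norm v k) (norm_pd_le_of_bounded h12 h2 hu hM hz k) (norm_nonneg _)
          (norm_nonneg _)
    _ = 2 * (M / ((r₂ - r₁) / 4)) * ‖v‖ := by
        rw [Finset.sum_const, Finset.card_univ, Fintype.card_fin]
        simp only [nsmul_eq_mul, Nat.cast_ofNat]
        ring

/-- **The Lipschitz bound on `cball r₁`**: `‖u z − u w‖ ≤ (2M / ρ) ‖z − w‖` for `z, w ∈ cball r₁`, when `u` is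
holomorphic and bounded by `M` on `oball r₂` (`r₁ < r₂ ≤ 1`, `ρ = (r₂ − r₁)/4`). -/
theorem norm_sub_le_of_bounded {r₁ r₂ : ℝ} (h12 : r₁ < r₂) (h2 : r₂ ≤ 1) {u : (Fin 2 → ℂ) → ℂ}
    (hu : DifferentiableOn ℂ u (oball r₂)) {M : ℝ} (hM : ∀ w ∈ oball r₂, ‖u w‖ ≤ M) {z w : Fin 2 → ℂ}
    (hz : z ∈ cball r₁) (hw : w ∈ cball r₁) : ‖u z - u w‖ ≤ 2 * (M / ((r₂ - r₁) / 4)) * ‖z - w‖ := by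
  refine Convex.norm_image_sub_le_of_norm_fderiv_le (𝕜 := ℂ) (fun x hx => ?_)
    (fun x hx => norm_fderiv_le_of_bounded h12 h2 hu hM hx) (convex_cball r₁) hw hz
  exact hu.differentiableAt ((isOpen_oball r₂).mem_nhds (cball_subset_oball h12 hx))

end Summit.Ventures.HodgeRepro.Tier4
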